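import Mathlib
import Summits.Ventures.PercRepro2.SwOutShadowMultiRootJunctions

/-!
# THE CANONICAL UNITS ARE CLUSTERED AND STRAY-FREE: the canonical conditions of the decorated
cubes reduce to the three LOCAL ones (blind cell PercRepro2, night-4 g36, 2026-08-29;
proofs/NIGHT4-G35.md §8 (a))

g35's fibre theorem `rigidOK_g_of_decoFibre` and the mark step `swAll_markStep_of_junctions_deco`
take SEVEN conditions at every side point: pure, disjoint, attached, CLUSTERED (a unit is the
cluster of its arm vertices in the red-unit configuration of its decorated base), STRAY-FREE (an
edge from an arm to the outside of the hull goes to the unit's decoration or to `l`), the units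
inside the region, and every escaping vertex routed.  Here the two structural ones are THEOREMS
of the side point: **`noStray_of_side`** — a red edge from a red-arm vertex to the outside would
put the outside vertex into the root's red cluster, so the edge is blue (not at `l` unless it
ends at `l`) and its end lies in the unit's cluster, i.e. in the decoration —, and
**`clustered_of_side`** — once the units are pure, disjoint and attached, no edge touching a unit
joins two roots or touches a unit of the other colour (`no_edge_of_ne_unitsR`), so the decorated
base agrees with the side point on every edge touching a red unit and negates every edge touching
a blue unit: the red-unit configuration of the base restricted to the edges touching the unit is
the side point's own unit configuration, and the cluster is the unit
(`cluster_eq_of_eqOn_touches`).  Hence **`DecoCanonicalLoc`** = pure ∧ disjoint ∧ attached ∧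
routed suffices: **`swAll_markStep_of_junctions_loc`** is the mark step with any set of
junctions under the three local conditions only (the units inside `{l}ᶜ` is automatic:
`l_notMem_of_mem_unitsR`).  The census (mining/night-4/g35/shadow14.py, design 14) checked
exactly these three conditions plus routing: n = 6 18,720 / 18,720, n = 7 217,934 / 219,240.
-/

namespace Summit.Ventures.PercRepro2

namespace LocRows

open Hull

variable {V : Type*} {E : Type*}

open scoped Classical

variable {ends : E → Sym2 V}

section Clusters

/-- Two configurations agreeing on every edge touching the cluster of `y` in the first have the
same cluster of `y`. -/
lemma cluster_eq_of_eqOn_touches {ρ σ : Config E} {y : V}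
    (h : ∀ e ∈ touches ends (cluster ends ρ y), σ e = ρ e) :
    cluster ends σ y = cluster ends ρ y := by
  apply Set.Subset.antisymm
  · intro x hx
    refine mem_of_conn_of_closed (ends := ends) (ω := σ) ?_ (mem_cluster_self _ _ _) hx
    intro a ha b hab
    obtain ⟨-, e, he, hab'⟩ := exists_edge_of_adj hab
    have he' : ρ e = true := by rw [← h e ⟨a, ha, b, hab'⟩]; exact he
    exact mem_cluster_of_edge ha he' hab'
  · intro x hx
    have key : x ∈ cluster ends ρ y ∩ cluster ends σ y := by
      refine mem_of_conn_of_closed (ends := ends) (ω := ρ) ?_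
        ⟨mem_cluster_self _ _ _, mem_cluster_self _ _ _⟩ hx
      rintro a ⟨ha, ha'⟩ b hab
      obtain ⟨-, e, he, hab'⟩ := exists_edge_of_adj hab
      have he' : σ e = true := by rw [h e ⟨a, ha, b, hab'⟩]; exact he
      exact ⟨mem_cluster_of_edge ha he hab', mem_cluster_of_edge ha' he' hab'⟩
    exact key.2

end Clusters

section Canonical

variable [Fintype E] [DecidableEq E] {U : Set V} {ξ : Config E} {l h : V} {R : Set V}
  {𝓤 𝓓 𝓓'' : Set (Set V)} {X : Set V} {𝓤' : Set (Set V)} {F : V → Prop} {ζ : Config E}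
  (hl : l ∉ U) (hloop : ∀ e r, r ∈ R → ends e ≠ s(r, r))
  (hF : ∀ x, F x → ∀ S ∈ 𝓤, x ∈ S)
  (hout : ∀ x ∈ U, x ∉ R →
    F x ∨ x ∈ X ∨ (∃ e y, ends e = s(x, y) ∧ y ∉ U) ∨ (∀ e, x ∉ ends e) ∨ ¬ hull ends ζ x ⊆ U)
  (hX : ∀ x ∈ X, x ∈ U → ∀ e, x ∈ ends e → ends e = s(x, x))
  (hζ : ζ ∈ gOutSide ends l h 𝓤 𝓓 𝓓'' X 𝓤' U ξ)
  (hne : ∀ r ∈ R, hull ends ζ r ⊆ U)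
include hl hF hout hX hζ hne

omit hF hout hX hζ in
/-- `l` lies in no unit of the family (no unit edge is at `l`, and `l` is outside the hull). -/
lemma l_notMem_of_mem_unitsR {u : Set V} (hu : u ∈ unitsR ends R l ζ) : l ∉ u := by
  obtain ⟨y, hyH, -, rfl⟩ := exists_of_mem_unitsR' hu
  have hlH : l ∉ extHullR ends R ζ := fun h' => hl (Esc.extHullR_subset_U hne h')
  exact l_notMem_unitOf hlH fun h' => hlH (h' ▸ hyH)

/-- **The canonical units are stray-free**: an edge from the arm part of a unit to the outside of
the hull goes to the unit's decoration or to `l` — at a red-arm vertex the edge is blue (a red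
edge would put its end into the root's red cluster, inside the hull), at a blue-arm vertex red;
not at `l`, it is an edge of the unit configuration and its end lies in the unit. -/
theorem noStray_of_side : NoStray ends R l ζ := by
  intro u hu e x y hxy hx hyH
  have hlH : l ∉ extHullR ends R ζ := fun h' => hl (Esc.extHullR_subset_U hne h')
  have hxl : x ≠ l := fun h' => hlH (h' ▸ hx.2)
  by_cases hyl : y = l
  · exact Or.inr hyl
  refine Or.inl ⟨?_, hyH⟩
  have hel : e ∉ touches ends {l} := by
    rintro ⟨z, hz, w, hzw⟩
    rw [Set.mem_singleton_iff] at hz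
    rw [hz, hxy, Sym2.eq_iff] at hzw
    rcases hzw with ⟨h1, -⟩ | ⟨-, h2⟩
    · exact hxl h1
    · exact hyl h2
  obtain ⟨y₀, hy₀H, hy₀R, rfl⟩ := exists_of_mem_unitsR' hu
  have hux : unitOf ends R l ζ x = unitOf ends R l ζ y₀ :=
    unitOf_eq_of_mem hl hF hout hX hζ hne hy₀H hy₀R hx.1 hx.2
  rw [← hux]
  rcases mem_redPartR_or_bluePartR hy₀H hy₀R with hy₀ | hy₀
  · -- a red unit: the edge is blue
    have hxr : x ∈ redPartR ends R ζ := unit_red_closed hl hF hout hX hζ hne hy₀ x hx.1 hx.2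
    have he : ζ e = false := by
      cases he : ζ e with
      | true =>
        exfalso
        obtain ⟨⟨r, hr, hxr'⟩, -⟩ := hxr
        exact hyH ⟨r, hr, Or.inl (mem_cluster_of_edge hxr' he hxy)⟩
      | false => rfl
    have hc : unitConfigB ends R l ζ e = true := unitConfigB_eq_true_iff.2 (Or.inl ⟨he, hel⟩)
    simp only [unitOf, if_pos hxr]
    exact mem_cluster_of_edge (mem_cluster_self _ _ _) hc hxy
  · -- a blue unit: the edge is red
    have hxb : x ∈ bluePartR ends R ζ := unit_blue_closed hl hF hout hX hζ hne hy₀ x hx.1 hx.2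
    have hxr : x ∉ redPartR ends R ζ := fun h' =>
      Esc.redPartR_disjoint_bluePartR hl hF hout hX hζ hne h' hxb
    have he : ζ e = true := by
      cases he : ζ e with
      | true => rfl
      | false =>
        exfalso
        obtain ⟨⟨r, hr, hxb'⟩, -⟩ := hxb
        have he' : blue ζ e = true := by rw [blue_eq_true_iff]; exact he
        exact hyH ⟨r, hr, Or.inr (mem_cluster_of_edge hxb' he' hxy)⟩
    have hc : unitConfigR ends R l ζ e = true := unitConfigR_eq_true_iff.2 (Or.inl ⟨he, hel⟩)
    simp only [unitOf, if_neg hxr]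
    exact mem_cluster_of_edge (mem_cluster_self _ _ _) hc hxy

/-- **No edge joins two distinct units** of a side point with pure, pairwise disjoint units: two
hull vertices joined by an edge share an arm, hence a unit; a decoration vertex sees its own unit
or `l` only, and `l` is in no unit. -/
theorem no_edge_of_ne_unitsR (hP : Pure ends R l ζ) (hD : UnitsDisjoint ends R l ζ)
    {u u' : Set V} (hu : u ∈ unitsR ends R l ζ) (hu' : u' ∈ unitsR ends R l ζ) (huu' : u ≠ u')
    {e : E} {a w : V} (haw : ends e = s(a, w)) (ha : a ∈ u) (hw : w ∈ u') : False := by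
  have hwu : w ∉ u := hD u' hu' u hu (Ne.symm huu') w hw
  have hau' : a ∉ u' := hD u hu u' hu' huu' a ha
  by_cases haH : a ∈ extHullR ends R ζ
  · by_cases hwH : w ∈ extHullR ends R ζ
    · -- both in the hull: the same arm, hence the same unit
      have haR : a ∉ R := fun h' => root_notMem_unit hl hF hout hX hζ hne hu h' ha
      have hwR : w ∉ R := fun h' => root_notMem_unit hl hF hout hX hζ hne hu' h' hw
      have hwa : w ∈ armR ends R ζ a := by
        have he : armConfigR ends R ζ e = true := by
          simp only [armConfigR, decide_eq_true_eq]
          exact ⟨a, ⟨haH, haR⟩, w, ⟨hwH, hwR⟩, haw⟩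
        exact mem_cluster_of_edge (mem_armR_self a) he haw
      exact hwu (armR_subset_of_mem_unitsR hl hF hout hX hζ hne hu ha haH hwa)
    · -- `w` is a decoration vertex of `u'`: its edge goes into `u'` or to `l`
      rcases hP u' hu' e w a (ends_swap haw) ⟨hw, hwH⟩ with h' | h' | h'
      · exact hau' h'.1
      · exact hau' h'.1
      · exact l_notMem_of_mem_unitsR hl hne hu (h' ▸ ha)
  · -- `a` is a decoration vertex of `u`
    rcases hP u hu e a w haw ⟨ha, haH⟩ with h' | h' | h'
    · exact hwu h'.1
    · exact hwu h'.1
    · exact l_notMem_of_mem_unitsR hl hne hu' (h' ▸ hw)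

include hloop in
/-- **The canonical units are clustered**: with pure, pairwise disjoint, attached units, every
unit is the cluster of each of its arm vertices in the red-unit configuration of the decorated
base — the base agrees with the side point on every edge touching a red unit (no such edge joins
two roots or touches a blue unit) and negates every edge touching a blue unit, so on the edges
touching the unit the red-unit configuration of the base is the side point's own unit
configuration, whose cluster is the unit. -/
theorem clustered_of_side (hP : Pure ends R l ζ) (hD : UnitsDisjoint ends R l ζ)
    (hA : Attached ends R l ζ) : Clustered ends R l ζ := by
  have hb := decoBaseE_baseDeco hl hloop hF hout hX hζ hne hP hD hA
  have hH : extHullR ends R (baseDeco ends R l ζ) = extHullR ends R ζ := hb.extHullR_base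
  intro u hu y hy
  have hyR : y ∉ R := (unitArm_subset hl hF hout hX hζ hne hu hy).2
  have huy : unitOf ends R l ζ y = u := unitOf_eq_of_mem_unitsR hl hF hout hX hζ hne hu hy.1 hy.2
  -- no edge touching a unit joins two roots
  have hrr : ∀ e ∈ touches ends u, e ∉ rrEdges ends R := by
    rintro e ⟨a, ha, w, haw⟩
    exact notMem_rrEdges_of_notMem haw fun h' => root_notMem_unit hl hF hout hX hζ hne hu h' ha
  rcases mem_redPartR_or_bluePartR hy.2 hyR with hyr | hyb
  · -- a red unit: no edge touching it touches the blue units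
    have hnb : ∀ e ∈ touches ends u, e ∉ touches ends (blueUnits ends R l ζ) := by
      rintro e ⟨a, ha, w, haw⟩ ⟨z, ⟨y', hy', hz⟩, v, hzv⟩
      have hu' : unitOf ends R l ζ y' ∈ unitsR ends R l ζ :=
        unitOf_mem_unitsR_of_mem hl hF hout hX hζ hne (bluePartR_subset hy') hy'.2
      have hne' : unitOf ends R l ζ y' ≠ u := by
        intro h'
        have hyb : y ∈ bluePartR ends R ζ :=
          unit_blue_closed hl hF hout hX hζ hne hy' y (by rw [h']; exact hy.1) hy.2
        exact Esc.redPartR_disjoint_bluePartR hl hF hout hX hζ hne hyr hyb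
      rw [haw, Sym2.eq_iff] at hzv
      rcases hzv with ⟨h1, -⟩ | ⟨-, h2⟩
      · rw [← h1] at hz
        exact hD _ hu' u hu hne' a hz ha
      · rw [← h2] at hz
        exact no_edge_of_ne_unitsR hl hF hout hX hζ hne hP hD hu hu' (Ne.symm hne') haw ha hz
    have hagree : ∀ e ∈ touches ends u,
        unitConfigB ends R l (baseDeco ends R l ζ) e = unitConfigB ends R l ζ e := by
      intro e he
      have hbase : baseDeco ends R l ζ e = ζ e := by
        rw [baseDeco_apply_of_notMem (hrr e he), flip_apply_of_notMem (hnb e he)]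
      simp only [unitConfigB, armConfigR, hH, blue, hbase]
    have hcl : u = cluster ends (unitConfigB ends R l ζ) y := by
      rw [← huy]; simp only [unitOf, if_pos hyr]
    rw [cluster_eq_of_eqOn_touches fun e he => hagree e (by rwa [hcl])]
    exact hcl
  · -- a blue unit: every edge touching it touches the blue units
    have hyr : y ∉ redPartR ends R ζ := fun h' =>
      Esc.redPartR_disjoint_bluePartR hl hF hout hX hζ hne h' hyb
    have hub : ∀ e ∈ touches ends u, e ∈ touches ends (blueUnits ends R l ζ) := by
      rintro e ⟨a, ha, w, haw⟩
      exact ⟨a, ⟨y, hyb, by rw [huy]; exact ha⟩, w, haw⟩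
    have hagree : ∀ e ∈ touches ends u,
        unitConfigB ends R l (baseDeco ends R l ζ) e = unitConfigR ends R l ζ e := by
      intro e he
      have hbase : baseDeco ends R l ζ e = !ζ e := by
        rw [baseDeco_apply_of_notMem (hrr e he), flip_apply_of_mem (hub e he)]
      simp only [unitConfigB, unitConfigR, armConfigR, hH, blue, hbase, Bool.not_not]
    have hcl : u = cluster ends (unitConfigR ends R l ζ) y := by
      rw [← huy]; simp only [unitOf, if_neg hyr]
    rw [cluster_eq_of_eqOn_touches fun e he => hagree e (by rwa [hcl])]
    exact hcl

include hloop in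
/-- **The canonical conditions from the local ones**: pure, disjoint, attached units inside the
region with every escaping vertex routed are canonical (clustered and stray-free for free). -/
theorem decoCanonical_of_loc (hP : Pure ends R l ζ) (hD : UnitsDisjoint ends R l ζ)
    (hA : Attached ends R l ζ) (hU : ∀ u ∈ unitsR ends R l ζ, u ⊆ U) {T : Set V}
    (hroute : ∀ u ∈ T, ∃ v ∈ unitsR ends R l ζ,
      u ∈ cluster ends (decoRoute ends v (baseDeco ends R l ζ)) l) :
    Pure ends R l ζ ∧ UnitsDisjoint ends R l ζ ∧ Attached ends R l ζ ∧
      Clustered ends R l ζ ∧ NoStray ends R l ζ ∧ (∀ u ∈ unitsR ends R l ζ, u ⊆ U) ∧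
      (∀ u ∈ T, ∃ v ∈ unitsR ends R l ζ,
        u ∈ cluster ends (decoRoute ends v (baseDeco ends R l ζ)) l) :=
  ⟨hP, hD, hA, clustered_of_side hl hloop hF hout hX hζ hne hP hD hA,
    noStray_of_side hl hF hout hX hζ hne, hU, hroute⟩

end Canonical

/-- **The LOCAL canonical conditions** at a side point with the roots `R` and the escaping set
`T`: pure, pairwise disjoint, attached units, every escaping vertex routed to `l` inside a unit
of the decorated base. -/
def DecoCanonicalLoc [Fintype E] [DecidableEq E] (ends : E → Sym2 V) (R : Set V) (l : V)
    (T : Set V) (ζ : Config E) : Prop :=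
  Pure ends R l ζ ∧ UnitsDisjoint ends R l ζ ∧ Attached ends R l ζ ∧
    (∀ u ∈ T, ∃ v ∈ unitsR ends R l ζ, u ∈ cluster ends (decoRoute ends v (baseDeco ends R l ζ)) l)

section Junctions

variable [Fintype E] [DecidableEq E] {U : Set V} {ξ : Config E} {l h : V}
  {𝓤 𝓓 𝓓'' : Set (Set V)} {X : Set V} {𝓤' : Set (Set V)} {F : V → Prop}

/-- **The canonical conditions on a fibre of the escaping set from the local ones**: at a side
point of a region with the junctions `J` whose escaping set is `T`, the local conditions with
the roots `h` and `J ∖ T` and the units inside the region give the canonical ones. -/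
theorem decoCanonical_of_junctions (hl : l ∉ U) {J : Finset V}
    (hloop : ∀ e r, r ∈ insert h (↑J : Set V) → ends e ≠ s(r, r))
    (hF : ∀ x, F x → ∀ S ∈ 𝓤, x ∈ S)
    (hout : ∀ x ∈ U, x ≠ h → x ∉ J →
      F x ∨ x ∈ X ∨ (∃ e y, ends e = s(x, y) ∧ y ∉ U) ∨ (∀ e, x ∉ ends e))
    (hX : ∀ x ∈ X, x ∈ U → ∀ e, x ∈ ends e → ends e = s(x, x))
    {T : Finset V} (hT : T ⊆ J) {ζ : Config E}
    (hζ : ζ ∈ gOutSide ends l h 𝓤 𝓓 𝓓'' X 𝓤' U ξ) (hesc : escSetE ends J U ζ = T)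
    (hcan : DecoCanonicalLoc ends (insert h (↑(J \ T) : Set V)) l (↑T) ζ)
    (hU : ∀ u ∈ unitsR ends (insert h (↑(J \ T) : Set V)) l ζ, u ⊆ U) :
    let R : Set V := insert h (↑(J \ T) : Set V)
    Pure ends R l ζ ∧ UnitsDisjoint ends R l ζ ∧ Attached ends R l ζ ∧
      Clustered ends R l ζ ∧ NoStray ends R l ζ ∧ (∀ u ∈ unitsR ends R l ζ, u ⊆ U) ∧
      (∀ u ∈ (↑T : Set V), ∃ v ∈ unitsR ends R l ζ,
        u ∈ cluster ends (decoRoute ends v (baseDeco ends R l ζ)) l) := by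
  obtain ⟨hP, hD, hA, hroute⟩ := hcan
  obtain ⟨hne, hT'⟩ := (mem_fibreE_iff hT hζ).1 hesc
  have hsub : insert h (↑(J \ T) : Set V) ⊆ insert h (↑J : Set V) := by
    rintro r (rfl | hr)
    · exact Or.inl rfl
    · rw [Finset.mem_coe, Finset.mem_sdiff] at hr
      exact Or.inr (Finset.mem_coe.2 hr.1)
  have hout' : ∀ x ∈ U, x ∉ insert h (↑(J \ T) : Set V) →
      F x ∨ x ∈ X ∨ (∃ e y, ends e = s(x, y) ∧ y ∉ U) ∨ (∀ e, x ∉ ends e) ∨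
        ¬ hull ends ζ x ⊆ U := by
    intro x hxU hxR
    have hxh : x ≠ h := fun h' => hxR (h' ▸ Or.inl rfl)
    by_cases hxJ : x ∈ J
    · have hxT : x ∈ T := by
        by_contra hxT
        exact hxR (Or.inr (by rw [Finset.mem_coe, Finset.mem_sdiff]; exact ⟨hxJ, hxT⟩))
      exact Or.inr (Or.inr (Or.inr (Or.inr (hT' x (Finset.mem_coe.2 hxT)))))
    · rcases hout x hxU hxh hxJ with hf | hxX | hout'' | hiso
      · exact Or.inl hf
      · exact Or.inr (Or.inl hxX)
      · exact Or.inr (Or.inr (Or.inl hout''))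
      · exact Or.inr (Or.inr (Or.inr (Or.inl hiso)))
  exact decoCanonical_of_loc hl (fun e r hr => hloop e r (hsub hr)) hF hout' hX hζ hne hP hD hA
    hU hroute

/-- **The multi-junction class from the decorated cubes under the local conditions**: g35's
`rigidOK_g_of_junctions_deco` with pure, disjoint, attached units inside the region and every
escaping junction routed, on every fibre of every class. -/
theorem rigidOK_g_of_junctions_loc (h𝓤 : IsUpperSet 𝓤) (h𝓓 : IsLowerSet 𝓓)
    (h𝓓'' : IsLowerSet 𝓓'') (h𝓤' : IsUpperSet 𝓤') (hl : l ∉ U) {J : Finset V}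
    (hloop : ∀ e r, r ∈ insert h (↑J : Set V) → ends e ≠ s(r, r))
    (hF : ∀ x, F x → ∀ S ∈ 𝓤, x ∈ S)
    (hout : ∀ x ∈ U, x ≠ h → x ∉ J →
      F x ∨ x ∈ X ∨ (∃ e y, ends e = s(x, y) ∧ y ∉ U) ∨ (∀ e, x ∉ ends e))
    (hX : ∀ x ∈ X, x ∈ U → ∀ e, x ∈ ends e → ends e = s(x, x))
    (hhX : h ∉ X) (hJX : ∀ u ∈ J, u ∉ X)
    (hcan : ∀ T ⊆ J, ∀ ζ ∈ gOutSide ends l h 𝓤 𝓓 𝓓'' X 𝓤' U ξ, escSetE ends J U ζ = T →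
      DecoCanonicalLoc ends (insert h (↑(J \ T) : Set V)) l (↑T) ζ ∧
        (∀ u ∈ unitsR ends (insert h (↑(J \ T) : Set V)) l ζ, u ⊆ U))
    {𝓔 : Set (Set E)} (h𝓔 : IsUpperSet 𝓔) :
    ((gOutSide ends l h 𝓤 𝓓 𝓓'' X 𝓤' U ξ).filter fun ζ => redEdges ends ζ h ∈ 𝓔).card ≤
      ((gOutSide ends l h 𝓤 𝓓 𝓓'' X 𝓤' U ξ).filter fun ζ => blueEdges ends ζ h ∈ 𝓔).card := by
  refine rigidOK_g_of_junctions_deco (F := F) (J := J) h𝓤 h𝓓 h𝓓'' h𝓤' hl hloop hF hout hX hhX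
    hJX ?_ h𝓔
  intro T hT ζ hζ hesc
  obtain ⟨hcan', hU⟩ := hcan T hT ζ hζ hesc
  exact decoCanonical_of_junctions hl hloop hF hout hX hT hζ hesc hcan' hU

end Junctions

end LocRows

end Summit.Ventures.PercRepro2
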